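import Mathlib
import Literature.Analysis.FluidPDE.VectorCalculus
import Literature.Analysis.FluidPDE.LeiZhang2011Proofs

/-!
# Continuous dependence on initial data for the self-similar binormal profile ODE
(helper for the registered stub `stub_mirrorPointSelection` of crux `FilamentSkeletonRss.SkeletonEquilibrium`,
stmt-NavierStokesRegularity-15400; the "continuous dependence" input of the reduction
`stub_mirrorPointSelection` ⟸ rigidity (`…GyrationFreeRigidity`, `…GyrationFreeArcs`) + continuous dependence +
compactness, see the docstring of `…GyrationFreeArcs`)

For `C²` unit-speed solutions of `Y″ = g • Y′ × A Y` (`A y = ½ y − α e₃ × y`):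
* `norm_le_of_unit_speed` — the a-priori bound `‖Y t‖ ≤ ‖Y 0‖ + |t|` (mean value inequality);
* `continuous_dependence` — two exact solutions staying in `‖·‖ ≤ ρ₁` on `[a, b]` satisfy, with
  `K = 1 + |g|(½+|α|)(ρ₁+2)` (`profileField_lipschitzOn`, the Lipschitz constant of the phase field on the box
  `‖Y‖ ≤ ρ₁`, `‖Y′‖ ≤ 2`, as in `ZeroAccretionSelection.outerField_lipschitzOn`) and
  `D = max ‖Y a − Z a‖ ‖Y′ a − Z′ a‖`, the Grönwall bound `‖Y t − Z t‖, ‖Y′ t − Z′ t‖ ≤ D · exp (K (t − a))` on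
  `[a, b]` (Mathlib's `dist_le_of_trajectories_ODE_of_mem` for the phase curves `(Y, Y′)`);
* `continuous_dependence_forward` — the same from `a = 0` on `[0, t]` with the a-priori box `ρ₁ = R + t` for data
  in `‖Y 0‖, ‖Z 0‖ ≤ R`: the pointwise-in-time Lipschitz dependence used to pass to limits of solutions.
No summit statement is proved; NS regularity is not touched.
-/

noncomputable section

open Set Filter Topology
open Literature.Analysis.FluidPDE
open scoped RealInnerProductSpace InnerProductSpace

namespace Summit.NavierStokesRegularity.NavierStokesRegularity.Theorems.SkeletonEquilibrium.MirrorPoint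
set_option linter.dupNamespace false

/-- **Lipschitz bound of the phase field** `(y, u) ↦ (u, g • u × A y)` on the box `{‖y‖ ≤ ρ₁, ‖u‖ ≤ 2}` in the sup
norm of `E × E`: constant `1 + |g|(½+|α|)(ρ₁+2)` (same statement as
`ZeroAccretionSelection.outerField_lipschitzOn`, re-proved here through `crossCLM` to keep this file's import
closure inside `Literature`). [folklore] -/
theorem profileField_lipschitzOn (g α ρ₁ : ℝ) (hρ₁ : 0 ≤ ρ₁) :
    LipschitzOnWith (Real.toNNReal (1 + |g| * (1 / 2 + |α|) * (ρ₁ + 2)))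
      (fun z : EuclideanSpace ℝ (Fin 3) × EuclideanSpace ℝ (Fin 3) =>
      (z.2, g • cross z.2 ((1 / 2 : ℝ) • z.1 - α • cross (EuclideanSpace.single (2 : Fin 3) (1 : ℝ)) z.1)))
      {z | ‖z.1‖ ≤ ρ₁ ∧ ‖z.2‖ ≤ 2} := by
  -- drift bound `‖A y‖ ≤ (½+|α|)‖y‖` (as in `ZeroAccretionSelection.norm_drift_le`, kept local here)
  have norm_drift_le' : ∀ y : EuclideanSpace ℝ (Fin 3),
      ‖(1 / 2 : ℝ) • y - α • cross (EuclideanSpace.single (2 : Fin 3) (1 : ℝ)) y‖ ≤ (1 / 2 + |α|) * ‖y‖ := by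
    intro y
    have hcr : ‖cross (EuclideanSpace.single (2 : Fin 3) (1 : ℝ)) y‖ ≤ ‖y‖ := by
      have := norm_cross_le_norm_mul_norm (EuclideanSpace.single (2 : Fin 3) (1 : ℝ)) y
      have he : ‖(EuclideanSpace.single (2 : Fin 3) (1 : ℝ))‖ = 1 := by simp
      rwa [he, one_mul] at this
    calc ‖(1 / 2 : ℝ) • y - α • cross (EuclideanSpace.single (2 : Fin 3) (1 : ℝ)) y‖
        ≤ ‖(1 / 2 : ℝ) • y‖ + ‖α • cross (EuclideanSpace.single (2 : Fin 3) (1 : ℝ)) y‖ := norm_sub_le _ _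
      _ = 1 / 2 * ‖y‖ + |α| * ‖cross (EuclideanSpace.single (2 : Fin 3) (1 : ℝ)) y‖ := by
          rw [norm_smul, norm_smul, Real.norm_eq_abs, Real.norm_eq_abs,
            abs_of_pos (by norm_num : (0:ℝ) < 1 / 2)]
      _ ≤ 1 / 2 * ‖y‖ + |α| * ‖y‖ := by gcongr
      _ = (1 / 2 + |α|) * ‖y‖ := by ring
  rw [lipschitzOnWith_iff_norm_sub_le]
  intro z hz z' hz'
  have hK : (0 : ℝ) ≤ 1 + |g| * (1 / 2 + |α|) * (ρ₁ + 2) := by positivity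
  rw [Real.coe_toNNReal _ hK]
  set A : EuclideanSpace ℝ (Fin 3) →L[ℝ] EuclideanSpace ℝ (Fin 3) :=
    (1 / 2 : ℝ) • ContinuousLinearMap.id ℝ _ -
      α • crossCLM (EuclideanSpace.single (2 : Fin 3) (1 : ℝ)) with hAdef
  have hA : ∀ y, A y = (1 / 2 : ℝ) • y - α • cross (EuclideanSpace.single (2 : Fin 3) (1 : ℝ)) y :=
    fun y => by simp [hAdef]
  have hdz : ‖z.1 - z'.1‖ ≤ ‖z - z'‖ := by
    have := norm_fst_le (z - z'); simpa using this
  have hdu : ‖z.2 - z'.2‖ ≤ ‖z - z'‖ := by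
    have := norm_snd_le (z - z'); simpa using this
  have hpos : (0 : ℝ) ≤ |g| * (1 / 2 + |α|) * (ρ₁ + 2) := by positivity
  -- second component as a `crossCLM` expression
  have e2 : g • cross z.2 ((1 / 2 : ℝ) • z.1 - α • cross (EuclideanSpace.single (2 : Fin 3) (1 : ℝ)) z.1) -
      g • cross z'.2 ((1 / 2 : ℝ) • z'.1 - α • cross (EuclideanSpace.single (2 : Fin 3) (1 : ℝ)) z'.1) =
      g • (crossCLM (z.2 - z'.2) (A z.1) + crossCLM z'.2 (A (z.1 - z'.1))) := by
    rw [← hA, ← hA, ← crossCLM_apply, ← crossCLM_apply, map_sub, map_sub, map_sub, ← smul_sub]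
    congr 1
    simp only [sub_apply]
    abel
  have hAz : ‖A z.1‖ ≤ (1 / 2 + |α|) * ρ₁ := by
    rw [hA]; exact (norm_drift_le' z.1).trans (mul_le_mul_of_nonneg_left hz.1 (by positivity))
  have hAd : ‖A (z.1 - z'.1)‖ ≤ (1 / 2 + |α|) * ‖z - z'‖ := by
    rw [hA]; exact (norm_drift_le' _).trans (mul_le_mul_of_nonneg_left hdz (by positivity))
  have h2 : ‖g • cross z.2 ((1 / 2 : ℝ) • z.1 - α • cross (EuclideanSpace.single (2 : Fin 3) (1 : ℝ)) z.1) -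
      g • cross z'.2 ((1 / 2 : ℝ) • z'.1 - α • cross (EuclideanSpace.single (2 : Fin 3) (1 : ℝ)) z'.1)‖ ≤
      (1 + |g| * (1 / 2 + |α|) * (ρ₁ + 2)) * ‖z - z'‖ := by
    rw [e2, norm_smul, Real.norm_eq_abs]
    calc |g| * ‖crossCLM (z.2 - z'.2) (A z.1) + crossCLM z'.2 (A (z.1 - z'.1))‖
        ≤ |g| * (‖crossCLM (z.2 - z'.2) (A z.1)‖ + ‖crossCLM z'.2 (A (z.1 - z'.1))‖) := by
          gcongr; exact norm_add_le _ _
      _ ≤ |g| * (‖z.2 - z'.2‖ * ‖A z.1‖ + ‖z'.2‖ * ‖A (z.1 - z'.1)‖) := by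
          gcongr <;> rw [crossCLM_apply] <;> exact norm_cross_le_norm_mul_norm _ _
      _ ≤ |g| * (‖z - z'‖ * ((1 / 2 + |α|) * ρ₁) + 2 * ((1 / 2 + |α|) * ‖z - z'‖)) := by
          gcongr
          · exact hz'.2
      _ = |g| * (1 / 2 + |α|) * (ρ₁ + 2) * ‖z - z'‖ := by ring
      _ ≤ (1 + |g| * (1 / 2 + |α|) * (ρ₁ + 2)) * ‖z - z'‖ := by
          gcongr; linarith
  have h1 : ‖z.2 - z'.2‖ ≤ (1 + |g| * (1 / 2 + |α|) * (ρ₁ + 2)) * ‖z - z'‖ :=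
    hdu.trans (by nlinarith [norm_nonneg (z - z')])
  rw [Prod.norm_def]
  exact max_le (by simpa using h1) (by simpa using h2)

/-- A-priori bound for a unit-speed `C²` curve: `‖Y t‖ ≤ ‖Y 0‖ + |t|` (mean value inequality on the segment
between `0` and `t`). [folklore] -/
theorem norm_le_of_unit_speed {Y : ℝ → EuclideanSpace ℝ (Fin 3)} (hY : ContDiff ℝ 2 Y)
    (hunit : ∀ s, ‖deriv Y s‖ = 1) (t : ℝ) : ‖Y t‖ ≤ ‖Y 0‖ + |t| := by
  have hYd : Differentiable ℝ Y := hY.differentiable (by norm_num)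
  have hb : ∀ x, ‖deriv Y x‖ ≤ 1 := fun x => (hunit x).le
  have key : ‖Y t - Y 0‖ ≤ 1 * ‖t - 0‖ :=
    Convex.norm_image_sub_le_of_norm_deriv_le (s := Set.univ) (fun x _ => hYd x) (fun x _ => hb x)
      convex_univ (Set.mem_univ 0) (Set.mem_univ t)
  rw [one_mul, sub_zero, Real.norm_eq_abs] at key
  calc ‖Y t‖ = ‖Y 0 + (Y t - Y 0)‖ := by rw [add_sub_cancel]
    _ ≤ ‖Y 0‖ + ‖Y t - Y 0‖ := norm_add_le _ _
    _ ≤ ‖Y 0‖ + |t| := by linarith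

/-- **Continuous dependence (Grönwall).** Two `C²` exact solutions of `Y″ = g • Y′ × A Y` with `‖Y′‖ = ‖Z′‖ = 1`,
both in `‖·‖ ≤ ρ₁` on `[a, b]`, satisfy `‖Y t − Z t‖, ‖Y′ t − Z′ t‖ ≤ max ‖Y a − Z a‖ ‖Y′ a − Z′ a‖ · e^{K(t−a)}`
on `[a, b]`, `K = 1 + |g|(½+|α|)(ρ₁+2)`. [folklore] -/
theorem continuous_dependence {g α ρ₁ a b : ℝ} {Y Z : ℝ → EuclideanSpace ℝ (Fin 3)}
    (hρ₁ : 0 ≤ ρ₁) (hY : ContDiff ℝ 2 Y) (hZ : ContDiff ℝ 2 Z)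
    (hunitY : ∀ s, ‖deriv Y s‖ = 1) (hunitZ : ∀ s, ‖deriv Z s‖ = 1)
    (hodeY : ∀ s, iteratedDeriv 2 Y s = g • cross (deriv Y s)
      ((1 / 2 : ℝ) • Y s - α • cross (EuclideanSpace.single (2 : Fin 3) (1 : ℝ)) (Y s)))
    (hodeZ : ∀ s, iteratedDeriv 2 Z s = g • cross (deriv Z s)
      ((1 / 2 : ℝ) • Z s - α • cross (EuclideanSpace.single (2 : Fin 3) (1 : ℝ)) (Z s)))
    (hin : ∀ t ∈ Icc a b, ‖Y t‖ ≤ ρ₁ ∧ ‖Z t‖ ≤ ρ₁) :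
    ∀ t ∈ Icc a b,
      ‖Y t - Z t‖ ≤ max ‖Y a - Z a‖ ‖deriv Y a - deriv Z a‖ *
          Real.exp ((1 + |g| * (1 / 2 + |α|) * (ρ₁ + 2)) * (t - a)) ∧
      ‖deriv Y t - deriv Z t‖ ≤ max ‖Y a - Z a‖ ‖deriv Y a - deriv Z a‖ *
          Real.exp ((1 + |g| * (1 / 2 + |α|) * (ρ₁ + 2)) * (t - a)) := by
  have h2 : ∀ W : ℝ → EuclideanSpace ℝ (Fin 3), iteratedDeriv 2 W = deriv (deriv W) :=
    fun W => by rw [iteratedDeriv_succ, iteratedDeriv_one]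
  have hodeY' : ∀ s, deriv (deriv Y) s = g • cross (deriv Y s)
      ((1 / 2 : ℝ) • Y s - α • cross (EuclideanSpace.single (2 : Fin 3) (1 : ℝ)) (Y s)) :=
    fun s => by rw [← h2]; exact hodeY s
  have hodeZ' : ∀ s, deriv (deriv Z) s = g • cross (deriv Z s)
      ((1 / 2 : ℝ) • Z s - α • cross (EuclideanSpace.single (2 : Fin 3) (1 : ℝ)) (Z s)) :=
    fun s => by rw [← h2]; exact hodeZ s
  set outerField := (fun z : EuclideanSpace ℝ (Fin 3) × EuclideanSpace ℝ (Fin 3) =>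
      (z.2, g • cross z.2 ((1 / 2 : ℝ) • z.1 - α • cross (EuclideanSpace.single (2 : Fin 3) (1 : ℝ)) z.1)))
    with houter
  set f : ℝ → EuclideanSpace ℝ (Fin 3) × EuclideanSpace ℝ (Fin 3) := fun t => (Y t, deriv Y t) with hfdef
  set k : ℝ → EuclideanSpace ℝ (Fin 3) × EuclideanSpace ℝ (Fin 3) := fun t => (Z t, deriv Z t) with hkdef
  have hYd : Differentiable ℝ Y := hY.differentiable (by norm_num)
  have hZd : Differentiable ℝ Z := hZ.differentiable (by norm_num)
  have hY'd : Differentiable ℝ (deriv Y) := hY.differentiable_deriv_two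
  have hZ'd : Differentiable ℝ (deriv Z) := hZ.differentiable_deriv_two
  have hfder : ∀ t, HasDerivAt f (outerField (f t)) t := fun t => by
    have := (hYd t).hasDerivAt.prodMk ((hY'd t).hasDerivAt.congr_deriv (hodeY' t))
    simpa [hfdef, houter] using this
  have hkder : ∀ t, HasDerivAt k (outerField (k t)) t := fun t => by
    have := (hZd t).hasDerivAt.prodMk ((hZ'd t).hasDerivAt.congr_deriv (hodeZ' t))
    simpa [hkdef, houter] using this
  have hfc : ContinuousOn f (Icc a b) := fun t _ => (hfder t).continuousAt.continuousWithinAt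
  have hkc : ContinuousOn k (Icc a b) := fun t _ => (hkder t).continuousAt.continuousWithinAt
  have hK : (0 : ℝ) ≤ 1 + |g| * (1 / 2 + |α|) * (ρ₁ + 2) := by positivity
  have hlip := profileField_lipschitzOn g α ρ₁ hρ₁
  have hfs : ∀ t ∈ Ico a b,
      f t ∈ {z : EuclideanSpace ℝ (Fin 3) × EuclideanSpace ℝ (Fin 3) | ‖z.1‖ ≤ ρ₁ ∧ ‖z.2‖ ≤ 2} :=
    fun t ht => ⟨(hin t (Ico_subset_Icc_self ht)).1, by
      change ‖deriv Y t‖ ≤ 2; rw [hunitY t]; norm_num⟩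
  have hks : ∀ t ∈ Ico a b,
      k t ∈ {z : EuclideanSpace ℝ (Fin 3) × EuclideanSpace ℝ (Fin 3) | ‖z.1‖ ≤ ρ₁ ∧ ‖z.2‖ ≤ 2} :=
    fun t ht => ⟨(hin t (Ico_subset_Icc_self ht)).2, by
      change ‖deriv Z t‖ ≤ 2; rw [hunitZ t]; norm_num⟩
  have hinit : dist (f a) (k a) ≤ max ‖Y a - Z a‖ ‖deriv Y a - deriv Z a‖ := by
    rw [dist_eq_norm, Prod.norm_def]
    simp [hfdef, hkdef]
  have key := dist_le_of_trajectories_ODE_of_mem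
    (v := fun _ => outerField) (s := fun _ => {z | ‖z.1‖ ≤ ρ₁ ∧ ‖z.2‖ ≤ 2})
    (fun t _ => hlip) hfc (fun t _ => (hfder t).hasDerivWithinAt) hfs hkc
    (fun t _ => (hkder t).hasDerivWithinAt) hks hinit
  intro t ht
  have h := key t ht
  rw [Real.coe_toNNReal _ hK, dist_eq_norm] at h
  have h1 : ‖Y t - Z t‖ ≤ ‖f t - k t‖ := by
    have := norm_fst_le (f t - k t); simpa using this
  have h2' : ‖deriv Y t - deriv Z t‖ ≤ ‖f t - k t‖ := by
    have := norm_snd_le (f t - k t); simpa using this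
  exact ⟨h1.trans h, h2'.trans h⟩

/-- **Forward continuous dependence from `t = 0`.** For two `C²` unit-speed exact solutions with
`‖Y 0‖, ‖Z 0‖ ≤ R` (`0 ≤ R`) and `0 ≤ t`:
`‖Y t − Z t‖, ‖Y′ t − Z′ t‖ ≤ max ‖Y 0 − Z 0‖ ‖Y′ 0 − Z′ 0‖ · exp ((1 + |g|(½+|α|)(R + t + 2)) t)`
(the box `ρ₁ = R + t` comes from `norm_le_of_unit_speed`). [folklore] -/
theorem continuous_dependence_forward {g α R : ℝ} {Y Z : ℝ → EuclideanSpace ℝ (Fin 3)}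
    (hR : 0 ≤ R) (hY : ContDiff ℝ 2 Y) (hZ : ContDiff ℝ 2 Z)
    (hunitY : ∀ s, ‖deriv Y s‖ = 1) (hunitZ : ∀ s, ‖deriv Z s‖ = 1)
    (hodeY : ∀ s, iteratedDeriv 2 Y s = g • cross (deriv Y s)
      ((1 / 2 : ℝ) • Y s - α • cross (EuclideanSpace.single (2 : Fin 3) (1 : ℝ)) (Y s)))
    (hodeZ : ∀ s, iteratedDeriv 2 Z s = g • cross (deriv Z s)
      ((1 / 2 : ℝ) • Z s - α • cross (EuclideanSpace.single (2 : Fin 3) (1 : ℝ)) (Z s)))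
    (hY0 : ‖Y 0‖ ≤ R) (hZ0 : ‖Z 0‖ ≤ R) {t : ℝ} (ht : 0 ≤ t) :
    ‖Y t - Z t‖ ≤ max ‖Y 0 - Z 0‖ ‖deriv Y 0 - deriv Z 0‖ *
        Real.exp ((1 + |g| * (1 / 2 + |α|) * (R + t + 2)) * t) ∧
    ‖deriv Y t - deriv Z t‖ ≤ max ‖Y 0 - Z 0‖ ‖deriv Y 0 - deriv Z 0‖ *
        Real.exp ((1 + |g| * (1 / 2 + |α|) * (R + t + 2)) * t) := by
  have hin : ∀ s ∈ Icc 0 t, ‖Y s‖ ≤ R + t ∧ ‖Z s‖ ≤ R + t := by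
    intro s hs
    have hs' : |s| ≤ t := by rw [abs_of_nonneg hs.1]; exact hs.2
    exact ⟨(norm_le_of_unit_speed hY hunitY s).trans (by linarith),
      (norm_le_of_unit_speed hZ hunitZ s).trans (by linarith)⟩
  have h := continuous_dependence (a := 0) (b := t) (by linarith : (0 : ℝ) ≤ R + t) hY hZ hunitY hunitZ
    hodeY hodeZ hin t ⟨ht, le_rfl⟩
  simpa only [sub_zero] using h

end Summit.NavierStokesRegularity.NavierStokesRegularity.Theorems.SkeletonEquilibrium.MirrorPoint
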